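import Summits.QuantumFields.YangMills.Theorems.BalabanUVNodesN15TwoGridEntry1
import Summits.QuantumFields.YangMills.Theorems.BalabanUVNodesN15BackwardShift
import HarnessLib

/-!
# Route «BalabanUVNodes» (K4 «SpineRates»), node N15 = NE2 — THE BACKWARD-DERIVATIVE ENTRY OF BAŁABAN's FULL LANDAU-GAUGE PAIR `(G′, G) = (Δ′_b⁻¹, Δ_b⁻¹)` AT `U ≡ 1`:
# `𝔇(S′_{−ν}∇′_νG′, S_{−ν}∇_νG) ≤ C·(L^k)^{−1∕16}·e^{−δ|y−y′|_T}`, HYPOTHESIS-FREE ON THE TORUS FAMILY OF RECORD (this seat's W1 shift device on dag-n15-a's parts 56∕59)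

Cell `pub-ymgap`, seat `pub-ymgap-dag-n15-c` (generation g7; R134 ACCELERATION SEAT, strategy s1; HUMAN RULING D-0062; chair R424 venue; `bears_on: R4∕N15`).  Filed
`--kind proof --supports stmt-QuantumFields-20509 --as helper` (K3⁶ `SpineGivenEndpointR13SepCoPR`, dag-lead WORDS-142; count-neutral).  Imports BY NAME dag-n15-a part 59
`…N15TwoGridEntry1` (`hasMaj_twoGridDefect_grad` = ENTRY 1 of (3.42) for the full pair, hypothesis-free; through it part 56 `hasMaj_holderSteps_pair`, part 42 `ineq110_114_pair` ∕
`hasMaj_grad_of_ineq`, part 33 `symbOp` ∕ `sT` ∕ `sD`, part 26 `blkFine_comp_kingPrV`) and this seat's g3 W1 `…N15BackwardShift` (`bshiftV`, `hasMaj_bshiftV_comp`, `hasMaj_idefShift_comp`);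
nothing in the tree is modified.

WHY.  The background-live knit of this seat (F16∕W4: the print's `V′₁(A′)` of (3.52) and the (3.60) words carry BOTH bond orientations, so its `U ≡ 1` letter list `uniform_layer_v1M`
indexes the derivative pieces by `Fin (d+1) ⊕ Fin (d+1)`: `inl μ ↦ ∇_μG`, `inr μ ↦ ∇⁻_μG = S_{−μ}∇_μG`) needs, to be re-run on Bałaban's FULL `U ≡ 1` propagator instead of the
single-scale piece (HANDOFF §g7 LOCATED (G5)), the η-DEFECT OF THE BACKWARD DERIVATIVE `S_{−ν}∇_νG` of the full pair — NOT an entry of (3.42), hence not on dag-n15-a's list.  It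
follows from their ENTRY 1 (part 59) by the g3 device `𝔇(S′T′, ST) = S′∘𝔇(T′, T) + 𝔇(S′, S)∘T` (W1): the first term is ENTRY 1 read one fine step back (cost `e^{δ}`), the second
vanishes on the lower block face and is the ONE-STEP BACKWARD DIFFERENCE of `∇_νG` inside (`hasMaj_idefShift_comp`), i.e. a Hölder step of the gradient — dag-n15-a part 56 at
`j = 1` (`(s_ν − 1)∇_νG ≤ C·(1∕L^k)^α·e^{−δd}`, when `4 ≤ L^k`), or the plain (1.110) majorant twice when `L^k < 4` (then `(1∕L^k)^α > 4^{−α}` absorbs the rate).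

WHAT THIS FILE IS (ns `Summit.QuantumFields.YangMills.BalabanUVNodes.N15.GenuineSite`).
* §1 `id_sub_bshiftV_eq` (`1 − S_{−ν} = S_{−ν}∘ρ(s_ν − 1)` on fine 1-forms), `hasMaj_oneStepBack_grad` (the one-step backward difference of `∇_νG` on the coarse grid:
  `≤ C·(L^k)^{−α}·e^{−δ|y−y′|_T}`, uniform, `0 ≤ α < 1`; both regimes of `L^k`).
* §2 ★★ **`hasMaj_twoGridDefect_grad_backward`**: for odd `L ≥ 3`, `b > 0`: `∃ δ C > 0 ∀ m_T, k ≥ 1, m, ν`,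
  `HasMaj (ofBlocks blkFine) (ofBlocks blockOf_{L^m·L^k}) (𝔇^{P}(S′_{−ν}∘∇′_νG′, S_{−ν}∘∇_νG)) (C·(L^k)^{−1∕16}·e^{−δ|y−y′|_T})` — the backward-derivative letter of the full pair,
  HYPOTHESIS-FREE (`S = bshiftV`, `∇_ν = symbOp (sD ν n)`, `G = gOp n b`, `P = pull prV`).
* §3 `hasMaj_gradBack_pair`: the PLAIN majorants `C·e^{−δ|y−y′|_T}` of the backward pieces at both spacings (F16's `hD` letters for the `inr` pieces; (1.110) read one step back).

HONEST FRAMING ∕ LIMITS.  One more `U ≡ 1` letter of the full pair for the located (G5) knit — not a (3.42) entry, not a node face; torus family of record (`M_μ = 2L^{m_T}`, odd `L ≥ 3`,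
King's pairing), fixed coupling `b`; constants crude and ours; MODEL-LEVEL bookkeeping over tree theorems.  NE2⁺ NOT PRINTED, NOT proved, not claimed; count-neutral (typed 28∕28 ·
discharged 5∕27 of record unchanged); N15 NOT discharged; one finite T⁴ at fixed ε — NOT ℝ⁴, NOT infinite volume, NOT OS, NOT a mass gap, NOT Clay.
-/

noncomputable section

open scoped BigOperators
open Finset

namespace Summit.QuantumFields.YangMills.BalabanUVNodes.N15.GenuineSite

open Literature.MathematicalPhysics.QuantumFieldTheory.Balaban1983to89
open Literature.MathematicalPhysics.QuantumFieldTheory.Balaban1983to89.B11SectG (BlockNorm HasMaj)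
open Literature.MathematicalPhysics.QuantumFieldTheory.Balaban1983to89.T4EtaRateDefect (idef idef_comp)
open Literature.MathematicalPhysics.QuantumFieldTheory.Balaban1983to89.T4EtaRateCoeffDefect (pull pull_apply)
open Literature.MathematicalPhysics.QuantumFieldTheory.Balaban1983to89.B5Prop11Plancherel (Tor fine unitVec)
open Literature.MathematicalPhysics.QuantumFieldTheory.Balaban1983to89.B5SiteBridgeP12 (MP)
open Literature.MathematicalPhysics.QuantumFieldTheory.Balaban1983to89.B6UnitTorusCarrier (unitTorusGeo)
open Literature.MathematicalPhysics.QuantumFieldTheory.King1986.Torus (blockOf tdistT tdistT_nonneg)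
open Summit.QuantumFields.YangMills.BalabanUVNodes.N15.TwoGrid (gOp symbOp sT sD symbOp_single_apply hasMaj_twoGridDefect_grad hasMaj_holderSteps_pair ineq110_114_pair
  hasMaj_grad_of_ineq paramsOf hasMaj_rate_mono)
open Summit.QuantumFields.YangMills.BalabanUVNodes.N15.VectorPiece (blkFine kingPrV blkFine_comp_kingPrV bshiftV bshiftV_apply hasMaj_bshiftV_comp hasMaj_idefShift_comp)

variable {d : ℕ} {L : ℕ} [NeZero L]

/-! ## §1 The one-step backward difference of the gradient of the full propagator -/

section OneStep

/-- `1 − S_{−ν} = S_{−ν}∘ρ(s_ν − 1)` on fine 1-forms: `f(x) − f(x − e_ν) = [(s_ν − 1)f](x − e_ν)`. [folklore] -/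
theorem id_sub_bshiftV_eq (M : Fin (d + 1) → ℕ) [∀ μ, NeZero (M μ)] (n : ℕ) [NeZero n] (ν : Fin (d + 1)) :
    (LinearMap.id - bshiftV M n ν : (Tor (fine n M) × Fin (d + 1) → ℝ) →ₗ[ℝ] (Tor (fine n M) × Fin (d + 1) → ℝ)) =
      bshiftV M n ν ∘ₗ symbOp M n (sT M n ν - 1) := by
  refine LinearMap.ext fun f => funext fun i => ?_
  show f i - f (i.1 - unitVec (fine n M) ν, i.2) = symbOp M n (sT M n ν - 1) f (i.1 - unitVec (fine n M) ν, i.2)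
  rw [map_sub, map_one, LinearMap.sub_apply, Pi.sub_apply, sT, symbOp_single_apply, one_mul, sub_add_cancel]
  rfl

/-- **THE ONE-STEP BACKWARD DIFFERENCE OF `∇_νG` ON THE COARSE GRID**: for odd `L ≥ 3`, `b > 0`, `0 ≤ α < 1` there are `δ, C > 0` with, on the torus family of record,
`(1 − S_{−ν})∘∇_νG ≤ C·(L^k)^{−α}·e^{−δ|y−y′|_T}` between the sharp unit-block norms — dag-n15-a part 56's Hölder step at `j = 1` read one step back (W1 `hasMaj_bshiftV_comp`) when
`4 ≤ L^k`, else the (1.110) majorant of `∇_νG` twice (`(1∕L^k)^α > 4^{−α}`). [cite: Balaban1984PropagatorsI, Prop. 1.2 (1.110)–(1.111) p.35; King1986, p.664 (pairing)] -/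
theorem hasMaj_oneStepBack_grad (hLodd : Odd L) (hL2 : 2 ≤ L) {b : ℝ} (hb : 0 < b) {α : ℝ} (hα0 : 0 ≤ α) (hα1 : α < 1) :
    ∃ δ C : ℝ, 0 < δ ∧ 0 < C ∧ ∀ (mT k m : ℕ) (_hk : 1 ≤ k) (hL : Odd L ∧ 1 < L) (ν : Fin (d + 1)),
      HasMaj (BlockNorm.ofBlocks (unitTorusGeo L k (MP (paramsOf d L mT k hL))) (blkFine L k (MP (paramsOf d L mT k hL))))
        (BlockNorm.ofBlocks (unitTorusGeo L k (MP (paramsOf d L mT k hL))) (blkFine L k (MP (paramsOf d L mT k hL))))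
        ((LinearMap.id - bshiftV (MP (paramsOf d L mT k hL)) (L ^ k) ν) ∘ₗ
          (symbOp (MP (paramsOf d L mT k hL)) (L ^ k) (sD (MP (paramsOf d L mT k hL)) (L ^ k) ν ((L ^ k : ℕ) : ℝ)) ∘ₗ gOp (MP (paramsOf d L mT k hL)) (L ^ k) b))
        (fun y y' => C * ((L ^ k : ℕ) : ℝ) ^ (-α) * Real.exp (-(δ * tdistT (MP (paramsOf d L mT k hL)) y y'))) := by
  have hL : Odd L ∧ 1 < L := ⟨hLodd, by omega⟩
  have hL0 : 0 < L := by omega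
  obtain ⟨δ₁, C₁, hδ₁, hC₁, HH⟩ := hasMaj_holderSteps_pair (d := d) hL hb hα0 hα1
  obtain ⟨δ₀, C₀, Cα, Cε, Cαε, hδ₀, hC₀, HP⟩ := ineq110_114_pair (d := d) hL hb
  set δ : ℝ := min δ₀ δ₁ with hδdef
  have hδ : 0 < δ := lt_min hδ₀ hδ₁
  -- one constant for both regimes
  set C : ℝ := C₁ * Real.exp δ + C₀ * (1 + Real.exp δ) * (4 : ℝ) ^ α with hCdef
  have h4α : (1 : ℝ) ≤ (4 : ℝ) ^ α := Real.one_le_rpow (by norm_num) hα0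
  have hC : 0 < C := by positivity
  refine ⟨δ, C, hδ, hC, fun mT k m hk hL' ν => ?_⟩
  have hproof : hL' = hL := rfl
  set M : Fin (d + 1) → ℕ := MP (paramsOf d L mT k hL') with hM
  have hn1 : 1 ≤ L ^ k := Nat.one_le_pow _ _ hL0
  have hnr : (1 : ℝ) ≤ ((L ^ k : ℕ) : ℝ) := by exact_mod_cast hn1
  have hnpos : (0 : ℝ) < ((L ^ k : ℕ) : ℝ) := by linarith
  have hdist : ∀ y y' : (unitTorusGeo L k M).Site, 0 ≤ (unitTorusGeo L k M).dist y y' := fun y y' => tdistT_nonneg _ _ _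
  have hrα : 0 ≤ ((L ^ k : ℕ) : ℝ) ^ (-α) := Real.rpow_nonneg hnpos.le _
  -- the (1.110) majorant of `∇_νG` at the common rate
  obtain ⟨HP1, -⟩ := HP mT k m hk
  have hD : HasMaj (BlockNorm.ofBlocks (unitTorusGeo L k M) (blkFine L k M)) (BlockNorm.ofBlocks (unitTorusGeo L k M) (blkFine L k M))
      (symbOp M (L ^ k) (sD M (L ^ k) ν ((L ^ k : ℕ) : ℝ)) ∘ₗ gOp M (L ^ k) b) (fun y y' => C₀ * Real.exp (-(δ * tdistT M y y'))) :=
    hasMaj_rate_mono hC₀.le (min_le_left δ₀ δ₁) (hasMaj_grad_of_ineq M k (L ^ k) b hn1 HP1 hC₀.le ν)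
  by_cases h4 : 4 ≤ L ^ k
  · -- Hölder step at `j = 1`, read one step back
    obtain ⟨H1, -⟩ := HH mT k m hk ν ν 1
    have hstep := hasMaj_rate_mono (mul_nonneg hC₁.le (Real.rpow_nonneg (by positivity) _)) (min_le_right δ₀ δ₁) (H1 (by omega))
    rw [pow_one] at hstep
    rw [id_sub_bshiftV_eq, LinearMap.comp_assoc]
    have key := hasMaj_bshiftV_comp M k (L ^ k) (b₁ := BlockNorm.ofBlocks (unitTorusGeo L k M) (blkFine L k M))
      (mul_nonneg hC₁.le (Real.rpow_nonneg (by positivity) _)) hδ.le ν hstep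
    refine key.mono fun y y' => ?_
    have hE := Real.exp_nonneg (-(δ * tdistT M y y'))
    have hq : ((1 : ℝ) / ((L ^ k : ℕ) : ℝ)) ^ α = ((L ^ k : ℕ) : ℝ) ^ (-α) := by
      rw [one_div, Real.inv_rpow hnpos.le, Real.rpow_neg hnpos.le]
    rw [Nat.cast_one, hq]
    have hle : C₁ * ((L ^ k : ℕ) : ℝ) ^ (-α) * Real.exp δ ≤ C * ((L ^ k : ℕ) : ℝ) ^ (-α) := by
      rw [hCdef]
      have h0 : 0 ≤ C₀ * (1 + Real.exp δ) * (4 : ℝ) ^ α * ((L ^ k : ℕ) : ℝ) ^ (-α) := by positivity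
      nlinarith
    exact mul_le_mul_of_nonneg_right hle hE
  · -- small `L^k`: the plain majorant twice, the rate absorbed by `4^α`
    have h4' : ((L ^ k : ℕ) : ℝ) < 4 := by exact_mod_cast (show L ^ k < 4 by omega)
    have hS := hasMaj_bshiftV_comp M k (L ^ k) (b₁ := BlockNorm.ofBlocks (unitTorusGeo L k M) (blkFine L k M)) hC₀.le hδ.le ν hD
    rw [LinearMap.sub_comp, LinearMap.id_comp]
    refine (hD.sub hS).mono fun y y' => ?_
    have hE := Real.exp_nonneg (-(δ * tdistT M y y'))
    -- `(1∕L^k)^α ≥ 4^{−α}`, so `1 ≤ 4^α (L^k)^{−α}`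
    have hrate : (1 : ℝ) ≤ (4 : ℝ) ^ α * ((L ^ k : ℕ) : ℝ) ^ (-α) := by
      rw [Real.rpow_neg hnpos.le, ← Real.inv_rpow hnpos.le, ← Real.mul_rpow (by norm_num) (inv_nonneg.mpr hnpos.le)]
      refine Real.one_le_rpow ?_ hα0
      rw [le_mul_inv_iff₀ hnpos]; linarith
    have hle : C₀ + C₀ * Real.exp δ ≤ C * ((L ^ k : ℕ) : ℝ) ^ (-α) := by
      rw [hCdef]
      have h0 : 0 ≤ C₁ * Real.exp δ * ((L ^ k : ℕ) : ℝ) ^ (-α) := by positivity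
      have h1 : C₀ * (1 + Real.exp δ) * 1 ≤ C₀ * (1 + Real.exp δ) * ((4 : ℝ) ^ α * ((L ^ k : ℕ) : ℝ) ^ (-α)) :=
        mul_le_mul_of_nonneg_left hrate (by positivity)
      nlinarith
    calc C₀ * Real.exp (-(δ * tdistT M y y')) + C₀ * Real.exp δ * Real.exp (-(δ * tdistT M y y')) = (C₀ + C₀ * Real.exp δ) * Real.exp (-(δ * tdistT M y y')) := by ring
      _ ≤ C * ((L ^ k : ℕ) : ℝ) ^ (-α) * Real.exp (-(δ * tdistT M y y')) := mul_le_mul_of_nonneg_right hle hE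

end OneStep

/-! ## §2 ★★ The backward-derivative entry of the full pair, hypothesis-free -/

section Backward

/-- ★★ **THE BACKWARD-DERIVATIVE ENTRY OF BAŁABAN's FULL LANDAU-GAUGE PAIR AT `U ≡ 1`, HYPOTHESIS-FREE.**  For odd `L ≥ 3` and `b > 0` there are `δ, C > 0` such that for every
torus exponent `m_T`, coarse scale `k ≥ 1`, refinement `m` and direction `ν`:
`HasMaj (ofBlocks blkFine) (ofBlocks blockOf_{L^m·L^k}) (𝔇^P(S′_{−ν}∘∇′_νG′, S_{−ν}∘∇_νG)) (C·(L^k)^{−1∕16}·e^{−δ|y−y′|_T})` — Leibniz for the shifted pair (`idef_comp`): the fine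
backward shift of ENTRY 1 (dag-n15-a part 59, W1 `hasMaj_bshiftV_comp`) plus the defect of the two shifts against `∇_νG`, which is majorised by the one-step backward difference of
`∇_νG` (W1 `hasMaj_idefShift_comp`, §1 at `α = ½`). [cite: Balaban1985BackgroundPropagators, (3.52) p.400 (the backward bond terms, shape); Balaban1984PropagatorsI, Prop. 1.2
(1.110)–(1.111) p.35; King1986, Prop. 3.9 (3.73) p.665 (rate shape), p.664 (pairing)] -/
theorem hasMaj_twoGridDefect_grad_backward (hLodd : Odd L) (hL2 : 2 ≤ L) {b : ℝ} (hb : 0 < b) :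
    ∃ δ C : ℝ, 0 < δ ∧ 0 < C ∧ ∀ (mT k m : ℕ) (hk : 1 ≤ k) (hL : Odd L ∧ 1 < L) (ν : Fin (d + 1)),
      HasMaj (BlockNorm.ofBlocks (unitTorusGeo L k (MP (paramsOf d L mT k hL))) (blkFine L k (MP (paramsOf d L mT k hL))))
        (BlockNorm.ofBlocks (unitTorusGeo L k (MP (paramsOf d L mT k hL)))
          (fun i : Tor (fine (L ^ m * L ^ k) (MP (paramsOf d L mT k hL))) × Fin (d + 1) => blockOf (L ^ m * L ^ k) (MP (paramsOf d L mT k hL)) i.1))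
        (idef (pull (kingPrV L k m (MP (paramsOf d L mT k hL)))) (pull (kingPrV L k m (MP (paramsOf d L mT k hL))))
          (bshiftV (MP (paramsOf d L mT k hL)) (L ^ m * L ^ k) ν ∘ₗ
            (symbOp (MP (paramsOf d L mT k hL)) (L ^ m * L ^ k) (sD (MP (paramsOf d L mT k hL)) (L ^ m * L ^ k) ν ((L ^ m * L ^ k : ℕ) : ℝ)) ∘ₗ
              gOp (MP (paramsOf d L mT k hL)) (L ^ m * L ^ k) b))
          (bshiftV (MP (paramsOf d L mT k hL)) (L ^ k) ν ∘ₗ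
            (symbOp (MP (paramsOf d L mT k hL)) (L ^ k) (sD (MP (paramsOf d L mT k hL)) (L ^ k) ν ((L ^ k : ℕ) : ℝ)) ∘ₗ gOp (MP (paramsOf d L mT k hL)) (L ^ k) b)))
        (fun y y' => C * ((L ^ k : ℕ) : ℝ) ^ (-(1 / 16 : ℝ)) * Real.exp (-(δ * tdistT (MP (paramsOf d L mT k hL)) y y'))) := by
  have hL : Odd L ∧ 1 < L := ⟨hLodd, by omega⟩
  have hL0 : 0 < L := by omega
  obtain ⟨δ₁, C₁, hδ₁, hC₁, H1⟩ := hasMaj_twoGridDefect_grad (d := d) hLodd hL2 hb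
  obtain ⟨δ₂, C₂, hδ₂, hC₂, H2⟩ := hasMaj_oneStepBack_grad (d := d) hLodd hL2 hb (α := 1 / 2) (by norm_num) (by norm_num)
  set δ : ℝ := min δ₁ δ₂ with hδdef
  have hδ : 0 < δ := lt_min hδ₁ hδ₂
  refine ⟨δ, C₁ * Real.exp δ + C₂, hδ, by positivity, fun mT k m hk hL' ν => ?_⟩
  set M : Fin (d + 1) → ℕ := MP (paramsOf d L mT k hL') with hM
  haveI : NeZero (L ^ m * L ^ k) := ⟨Nat.mul_ne_zero (pow_ne_zero _ (NeZero.ne L)) (pow_ne_zero _ (NeZero.ne L))⟩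
  have hn1 : 1 ≤ L ^ k := Nat.one_le_pow _ _ hL0
  have hnr : (1 : ℝ) ≤ ((L ^ k : ℕ) : ℝ) := by exact_mod_cast hn1
  have hnpos : (0 : ℝ) < ((L ^ k : ℕ) : ℝ) := by linarith
  have hdist : ∀ y y' : (unitTorusGeo L k M).Site, 0 ≤ (unitTorusGeo L k M).dist y y' := fun y y' => tdistT_nonneg _ _ _
  have hr16 : 0 ≤ ((L ^ k : ℕ) : ℝ) ^ (-(1 / 16 : ℝ)) := Real.rpow_nonneg hnpos.le _
  -- the two letters at the common rate and the common exponent `1/16`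
  have e1 := hasMaj_rate_mono (mul_nonneg hC₁.le hr16) (min_le_left δ₁ δ₂) (H1 mT k m hk hL' ν)
  have e2' := H2 mT k m hk hL' ν
  have hhalf : ((L ^ k : ℕ) : ℝ) ^ (-(1 / 2 : ℝ)) ≤ ((L ^ k : ℕ) : ℝ) ^ (-(1 / 16 : ℝ)) :=
    Real.rpow_le_rpow_of_exponent_le hnr (by norm_num)
  have e2 : HasMaj (BlockNorm.ofBlocks (unitTorusGeo L k M) (blkFine L k M)) (BlockNorm.ofBlocks (unitTorusGeo L k M) (blkFine L k M))
      ((LinearMap.id - bshiftV M (L ^ k) ν) ∘ₗ (symbOp M (L ^ k) (sD M (L ^ k) ν ((L ^ k : ℕ) : ℝ)) ∘ₗ gOp M (L ^ k) b))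
      (fun y y' => C₂ * ((L ^ k : ℕ) : ℝ) ^ (-(1 / 16 : ℝ)) * Real.exp (-(δ * tdistT M y y'))) := by
    refine (hasMaj_rate_mono (mul_nonneg hC₂.le (Real.rpow_nonneg hnpos.le _)) (min_le_right δ₁ δ₂) e2').mono fun y y' => ?_
    exact mul_le_mul_of_nonneg_right (mul_le_mul_of_nonneg_left hhalf hC₂.le) (Real.exp_nonneg _)
  -- Leibniz for the shifted pair: `𝔇(S′D′, SD) = S′∘𝔇(D′, D) + 𝔇(S′, S)∘D`
  have hA := hasMaj_bshiftV_comp M k (L ^ m * L ^ k) (b₁ := BlockNorm.ofBlocks (unitTorusGeo L k M) (blkFine L k M)) (mul_nonneg hC₁.le hr16) hδ.le ν e1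
  have hB : HasMaj (BlockNorm.ofBlocks (unitTorusGeo L k M) (blkFine L k M))
      (BlockNorm.ofBlocks (unitTorusGeo L k M) (fun i : Tor (fine (L ^ m * L ^ k) M) × Fin (d + 1) => blockOf (L ^ m * L ^ k) M i.1))
      (idef (pull (kingPrV L k m M)) (pull (kingPrV L k m M)) (bshiftV M (L ^ m * L ^ k) ν) (bshiftV M (L ^ k) ν) ∘ₗ
        (symbOp M (L ^ k) (sD M (L ^ k) ν ((L ^ k : ℕ) : ℝ)) ∘ₗ gOp M (L ^ k) b))
      (fun y y' => C₂ * ((L ^ k : ℕ) : ℝ) ^ (-(1 / 16 : ℝ)) * Real.exp (-(δ * tdistT M y y'))) := by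
    rw [← blkFine_comp_kingPrV M L k m]
    exact hasMaj_idefShift_comp M k m (b₁ := BlockNorm.ofBlocks (unitTorusGeo L k M) (blkFine L k M))
      (fun y y' => mul_nonneg (mul_nonneg hC₂.le hr16) (Real.exp_nonneg _)) ν e2
  refine ((hA.add hB).mono fun y y' => le_of_eq ?_).congr fun μ => ?_
  · show C₁ * ((L ^ k : ℕ) : ℝ) ^ (-(1 / 16 : ℝ)) * Real.exp δ * Real.exp (-(δ * tdistT M y y')) + C₂ * ((L ^ k : ℕ) : ℝ) ^ (-(1 / 16 : ℝ)) * Real.exp (-(δ * tdistT M y y'))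
      = (C₁ * Real.exp δ + C₂) * ((L ^ k : ℕ) : ℝ) ^ (-(1 / 16 : ℝ)) * Real.exp (-(δ * tdistT M y y'))
    ring
  exact (LinearMap.congr_fun (idef_comp (pull (kingPrV L k m M)) (pull (kingPrV L k m M)) (pull (kingPrV L k m M)) (bshiftV M (L ^ m * L ^ k) ν)
    (symbOp M (L ^ m * L ^ k) (sD M (L ^ m * L ^ k) ν ((L ^ m * L ^ k : ℕ) : ℝ)) ∘ₗ gOp M (L ^ m * L ^ k) b) (bshiftV M (L ^ k) ν)
    (symbOp M (L ^ k) (sD M (L ^ k) ν ((L ^ k : ℕ) : ℝ)) ∘ₗ gOp M (L ^ k) b)) μ).symm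

end Backward

/-! ## §3 The plain majorants of the backward-derivative pieces at both spacings -/

section Plain

/-- **THE BACKWARD-DERIVATIVE PIECES OF THE FULL PAIR HAVE UNIFORM PLAIN MAJORANTS** (the `hD` letters of F16's list for the `inr` pieces): for odd `L ≥ 3`, `b > 0` there are
`δ, C > 0` with, on the torus family of record and for every direction `ν`, `S_{−ν}∇_νG ≤ C·e^{−δ|y−y′|_T}` on the coarse grid (blocks `blkFine`) and `S′_{−ν}∇′_νG′ ≤ C·e^{−δ|y−y′|_T}`
on the fine grid (blocks `blockOf_{L^m·L^k}`) — (1.110) (`ineq110_114_pair`, `hasMaj_grad_of_ineq`) read one step back (W1 `hasMaj_bshiftV_comp`).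
[cite: Balaban1984PropagatorsI, Prop. 1.2 (1.110) p.35; Balaban1984PropagatorsII, (2.52)–(2.55) pp.232–233 (block-majorant bookkeeping, shape)] -/
theorem hasMaj_gradBack_pair (hL2 : 2 ≤ L) (hL : Odd L ∧ 1 < L) {b : ℝ} (hb : 0 < b) :
    ∃ δ C : ℝ, 0 < δ ∧ 0 < C ∧ ∀ (mT k m : ℕ) (_hk : 1 ≤ k) (ν : Fin (d + 1)),
      HasMaj (BlockNorm.ofBlocks (unitTorusGeo L k (MP (paramsOf d L mT k hL))) (blkFine L k (MP (paramsOf d L mT k hL))))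
          (BlockNorm.ofBlocks (unitTorusGeo L k (MP (paramsOf d L mT k hL))) (blkFine L k (MP (paramsOf d L mT k hL))))
          (bshiftV (MP (paramsOf d L mT k hL)) (L ^ k) ν ∘ₗ
            (symbOp (MP (paramsOf d L mT k hL)) (L ^ k) (sD (MP (paramsOf d L mT k hL)) (L ^ k) ν ((L ^ k : ℕ) : ℝ)) ∘ₗ gOp (MP (paramsOf d L mT k hL)) (L ^ k) b))
          (fun y y' => C * Real.exp (-(δ * tdistT (MP (paramsOf d L mT k hL)) y y'))) ∧
      HasMaj (BlockNorm.ofBlocks (unitTorusGeo L k (MP (paramsOf d L mT k hL)))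
            (fun i : Tor (fine (L ^ m * L ^ k) (MP (paramsOf d L mT k hL))) × Fin (d + 1) => blockOf (L ^ m * L ^ k) (MP (paramsOf d L mT k hL)) i.1))
          (BlockNorm.ofBlocks (unitTorusGeo L k (MP (paramsOf d L mT k hL)))
            (fun i : Tor (fine (L ^ m * L ^ k) (MP (paramsOf d L mT k hL))) × Fin (d + 1) => blockOf (L ^ m * L ^ k) (MP (paramsOf d L mT k hL)) i.1))
          (bshiftV (MP (paramsOf d L mT k hL)) (L ^ m * L ^ k) ν ∘ₗ
            (symbOp (MP (paramsOf d L mT k hL)) (L ^ m * L ^ k) (sD (MP (paramsOf d L mT k hL)) (L ^ m * L ^ k) ν ((L ^ m * L ^ k : ℕ) : ℝ)) ∘ₗ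
              gOp (MP (paramsOf d L mT k hL)) (L ^ m * L ^ k) b))
          (fun y y' => C * Real.exp (-(δ * tdistT (MP (paramsOf d L mT k hL)) y y'))) := by
  have hL0 : 0 < L := by omega
  obtain ⟨δ₀, C₀, Cα, Cε, Cαε, hδ₀, hC₀, HP⟩ := ineq110_114_pair (d := d) hL hb
  refine ⟨δ₀, C₀ * Real.exp δ₀, hδ₀, by positivity, fun mT k m hk ν => ?_⟩
  set M : Fin (d + 1) → ℕ := MP (paramsOf d L mT k hL) with hM
  haveI : NeZero (L ^ m * L ^ k) := ⟨Nat.mul_ne_zero (pow_ne_zero _ (NeZero.ne L)) (pow_ne_zero _ (NeZero.ne L))⟩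
  have hn1 : 1 ≤ L ^ k := Nat.one_le_pow _ _ hL0
  have hn'1 : 1 ≤ L ^ m * L ^ k := Nat.one_le_iff_ne_zero.mpr (Nat.mul_ne_zero (pow_ne_zero _ (NeZero.ne L)) (pow_ne_zero _ (NeZero.ne L)))
  obtain ⟨HP1, HP2⟩ := HP mT k m hk
  exact ⟨hasMaj_bshiftV_comp M k (L ^ k) (b₁ := BlockNorm.ofBlocks (unitTorusGeo L k M) (blkFine L k M)) hC₀.le hδ₀.le ν
      (hasMaj_grad_of_ineq M k (L ^ k) b hn1 HP1 hC₀.le ν),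
    hasMaj_bshiftV_comp M k (L ^ m * L ^ k)
      (b₁ := BlockNorm.ofBlocks (unitTorusGeo L k M) (fun i : Tor (fine (L ^ m * L ^ k) M) × Fin (d + 1) => blockOf (L ^ m * L ^ k) M i.1)) hC₀.le hδ₀.le ν
      (hasMaj_grad_of_ineq M k (L ^ m * L ^ k) b hn'1 HP2 hC₀.le ν)⟩

end Plain

end Summit.QuantumFields.YangMills.BalabanUVNodes.N15.GenuineSite
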